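import Mathlib
/-!
# Hodge-locus census, V3-XT N = 1 — ENGINE A: the NORM FORM of the RR-pair term (THEOREM-sketch RR-gen(ℓ), countersign target T14)

certified instances and evidence bearing on the general Hodge conjecture; no claim.

Records `DERIVATION-RR-A.md` of the pub-hlocus cell (seat abs-1, engine A, gen 30).  Engine B (seat abs-2) states the per-pair law of
THEOREM-sketch RR-gen(ℓ) — `ℓ` an odd prime, `D_a = ℓ d_a`, `D_b = ℓ d_b` fundamental discriminants divisible by `ℓ`, `Π_a`, `Π_b`
trace-zero elements of a maximal order `O_i ⊂ B_{ℓ,∞}` with `Π_a² = D_a`, `Π_b² = D_b`, `u` the `ℓ`-adic square root of `d_b/d_a` fixed by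
the orientation — with the TRACE-FORM term `v_ℓ(2u·D_a − trd(Π_a·x))`, `x = γΠ_bγ⁻¹`.  Engine A's machine (RRA) computes instead the
NORM-FORM term `v_ℓ(nrd(x − u·Π_a))`, i.e. the reduced norm of `x − uΠ_a` in `B ⊗ ℚ_ℓ(u)`.  This file is the kernel-checked DICTIONARY between
the two: in scale-free integer coordinates on `1, i, j, k` of `(a,b)_R` over ANY commutative ring `R`,
* `nrd (x − u•p) = nrd x + u²·nrd p + u·trd (p·x)` for trace-zero `p`, `x` (`nrd_sub_smul_of_re_zero`);
* hence under `nrd p = −ℓ d_a`, `nrd x = −ℓ d_b`, `d_a u² = d_b`:  `nrd (x − u•p) = −u·(2u(ℓ d_a) − trd (p·x)) = −2ℓ d_b + u·trd (p·x)`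
  (`normForm_eq_neg_u_mul_traceForm`, `normForm_eq`), and B's `2u·D_a − trd(Π_a x)` is `2u(ℓ d_a) − trd (p·x)`;
* so for a unit `u` the two terms are ASSOCIATED (`associated_normForm_traceForm`) and, over `ℤ_[p]`, have the same norm, i.e. the same
  valuation (`padicNorm_normForm_eq`);
* and the side facts RRA checks at run time: a trace-zero `p` has `p·p = −(nrd p)·1` (`qmul_self_of_re_zero`, so `Π² = D ⟺ nrd Π = −D`), and
  `trd (p·x) = trd (x·p)` (`trd_qmul_comm`).
Nothing here is a statement about algebraic cycles; every proof is a ring identity or a one-line consequence.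
-/

set_option linter.dupNamespace false

namespace Summit.HodgeConjecture.HodgeConjecture.HodgeLocus.Census.RamRamNormForm

variable {R : Type*} [CommRing R]

/-- Coordinates `(x₀, x₁, x₂, x₃)` of `x₀ + x₁ i + x₂ j + x₃ k` in `(a,b)_R` (`i² = a`, `j² = b`, `k = ij = −ji`). -/
abbrev Q (R : Type*) := R × R × R × R

/-- The quaternion product in `(a,b)_R`. -/
def qmul (a b : R) (x y : Q R) : Q R :=
  (x.1 * y.1 + a * x.2.1 * y.2.1 + b * x.2.2.1 * y.2.2.1 - a * b * x.2.2.2 * y.2.2.2,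
   x.1 * y.2.1 + x.2.1 * y.1 - b * x.2.2.1 * y.2.2.2 + b * x.2.2.2 * y.2.2.1,
   x.1 * y.2.2.1 + x.2.2.1 * y.1 + a * x.2.1 * y.2.2.2 - a * x.2.2.2 * y.2.1,
   x.1 * y.2.2.2 + x.2.2.2 * y.1 + x.2.1 * y.2.2.1 - x.2.2.1 * y.2.1)

/-- Reduced norm `x₀² − a x₁² − b x₂² + ab x₃²`. -/
def nrd (a b : R) (x : Q R) : R := x.1 ^ 2 - a * x.2.1 ^ 2 - b * x.2.2.1 ^ 2 + a * b * x.2.2.2 ^ 2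

/-- Reduced trace `2x₀`. -/
def trd (x : Q R) : R := 2 * x.1

/-- `x − u•p` in coordinates. -/
def subSMul (u : R) (x p : Q R) : Q R := (x.1 - u * p.1, x.2.1 - u * p.2.1, x.2.2.1 - u * p.2.2.1, x.2.2.2 - u * p.2.2.2)

/-- The product is associative (sanity check of the conventions). -/
theorem qmul_assoc (a b : R) (x y z : Q R) : qmul a b (qmul a b x y) z = qmul a b x (qmul a b y z) := by
  unfold qmul; ext <;> simp only <;> ring

/-- The norm is multiplicative (sanity check of the conventions). -/
theorem nrd_qmul (a b : R) (x y : Q R) : nrd a b (qmul a b x y) = nrd a b x * nrd a b y := by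
  unfold nrd qmul; simp only; ring

/-- `trd (x·y) = trd (y·x)`: the pairing `T_γ = trd(Π_a·x)` RRA computes is symmetric. -/
theorem trd_qmul_comm (a b : R) (x y : Q R) : trd (qmul a b x y) = trd (qmul a b y x) := by
  unfold trd qmul; simp only; ring

/-- A trace-zero element squares to the scalar `−nrd`: `Π² = D ⟺ nrd Π = −D` for pure quaternions. -/
theorem qmul_self_of_re_zero (a b : R) (p : Q R) (hp : p.1 = 0) : qmul a b p p = (-(nrd a b p), 0, 0, 0) := by
  unfold qmul nrd; ext <;> simp only [hp] <;> ring

/-- ENGINE A ↔ ENGINE B dictionary, polynomial form: for trace-zero `p`, `x`,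
`nrd (x − u•p) = nrd x + u²·nrd p + u·trd (p·x)`. -/
theorem nrd_sub_smul_of_re_zero (a b u : R) (x p : Q R) (hx : x.1 = 0) (hp : p.1 = 0) :
    nrd a b (subSMul u x p) = nrd a b x + u ^ 2 * nrd a b p + u * trd (qmul a b p x) := by
  unfold nrd subSMul trd qmul; simp only [hx, hp]; ring

/-- The RR-pair setting: `p = Π_a` with `nrd p = −ℓ d_a` (`Π_a² = D_a = ℓ d_a`), `x = γΠ_bγ⁻¹` with `nrd x = −ℓ d_b`, and `d_a u² = d_b`.
Then engine A's norm form is `−u` times engine B's trace form `2u·D_a − trd(Π_a x)`. -/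
theorem normForm_eq_neg_u_mul_traceForm (a b u ℓ da db : R) (x p : Q R) (hx : x.1 = 0) (hp : p.1 = 0)
    (hpa : nrd a b p = -(ℓ * da)) (hxb : nrd a b x = -(ℓ * db)) (hu : da * u ^ 2 = db) :
    nrd a b (subSMul u x p) = -u * (2 * u * (ℓ * da) - trd (qmul a b p x)) := by
  rw [nrd_sub_smul_of_re_zero a b u x p hx hp, hpa, hxb]
  linear_combination ℓ * hu

/-- Same, in the form RRA evaluates: `nrd (x − uΠ_a) = 2|D_b| + u·T` with `|D_b| = −ℓ d_b`, `T = trd(Π_a x)`. -/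
theorem normForm_eq (a b u ℓ da db : R) (x p : Q R) (hx : x.1 = 0) (hp : p.1 = 0)
    (hpa : nrd a b p = -(ℓ * da)) (hxb : nrd a b x = -(ℓ * db)) (hu : da * u ^ 2 = db) :
    nrd a b (subSMul u x p) = 2 * (-(ℓ * db)) + u * trd (qmul a b p x) := by
  rw [nrd_sub_smul_of_re_zero a b u x p hx hp, hpa, hxb]
  linear_combination (-ℓ) * hu

/-- For a unit `u` the two terms are associated, so they have the same valuation in any valuation ring containing the coordinates. -/
theorem associated_normForm_traceForm (a b u ℓ da db : R) (x p : Q R) (hx : x.1 = 0) (hp : p.1 = 0)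
    (hpa : nrd a b p = -(ℓ * da)) (hxb : nrd a b x = -(ℓ * db)) (hu : da * u ^ 2 = db) (hunit : IsUnit u) :
    Associated (nrd a b (subSMul u x p)) (2 * u * (ℓ * da) - trd (qmul a b p x)) := by
  rw [normForm_eq_neg_u_mul_traceForm a b u ℓ da db x p hx hp hpa hxb hu]
  obtain ⟨w, hw⟩ := hunit
  refine Associated.symm ⟨-w, ?_⟩
  rw [← hw]; push_cast; ring

/-- Over `ℤ_[q]`: engine A's term and engine B's term have the same `q`-adic norm (hence the same valuation) whenever `u` is a unit —
which is the case in RR-gen(ℓ) (`u² = d_b/d_a` with `ℓ ∤ d_a d_b`). -/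
theorem padicNorm_normForm_eq (q : ℕ) [Fact q.Prime] (a b u ℓ da db : ℤ_[q]) (x p : Q ℤ_[q]) (hx : x.1 = 0) (hp : p.1 = 0)
    (hpa : nrd a b p = -(ℓ * da)) (hxb : nrd a b x = -(ℓ * db)) (hu : da * u ^ 2 = db) (hunit : ‖u‖ = 1) :
    ‖nrd a b (subSMul u x p)‖ = ‖2 * u * (ℓ * da) - trd (qmul a b p x)‖ := by
  rw [normForm_eq_neg_u_mul_traceForm a b u ℓ da db x p hx hp hpa hxb hu, norm_mul, norm_neg, hunit, one_mul]

/-- Sanity evaluation of the conventions in `(−2,−5)_ℤ` (engine A's model of `B_{5,∞}`): `nrd (0,1,0,1) = 2 + 10 = 12`, `nrd (0,0,1,0) = 5`. -/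
example : nrd (-2 : ℤ) (-5) (0, 1, 0, 1) = 12 ∧ nrd (-2 : ℤ) (-5) (0, 0, 1, 0) = 5 := by
  unfold nrd; norm_num

end Summit.HodgeConjecture.HodgeConjecture.HodgeLocus.Census.RamRamNormForm
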